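import Literature.NumberTheory.EllipticCurves.BSDSelmerSmithRootNumberDensityProofs
import HarnessLib

/-!
# Density bookkeeping for the family `𝓕 = {d squarefree : d ≡ 1 (mod 4)}` of good twists at `2`

Cell `bsd-goldfeld` (planner seat), file 2 of 3 (the local analysis at `2` is
`GoldfeldGoodTwistsLocalTwo`, the assembly for `X₀(49)` is `GoldfeldGoodTwistsX049`). Theorems only —
no named fact, no axiom, no definition. HONEST FRAMING: elementary counting in the currency of the
tree's `twistDensity` (Smith's normalisation: both signs of `d`, ordered by `|d|`); nothing deep.
"`P` holds for `100 %` of `d ∈ 𝓕`" (relative density one) is written out as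
`Tendsto (fun X ↦ #{d ∈ 𝓕 : |d| ≤ X, P d} / #{d ∈ 𝓕 : |d| ≤ X}) atTop (𝓝 1)` with `Nat.card` of sets.

**Main statements.**

* `card_squarefree_le_five_mul_card_emod_four_eq_one` / `natCard_squarefree_le_five_mul` — `𝓕` HAS
  POSITIVE LOWER DENSITY: `#{d squarefree : |d| ≤ X} ≤ 5 · #{d ∈ 𝓕 : |d| ≤ X}`, from the tree's fibre
  decomposition `d = δ χ₄(m) m` (`δ ∈ {±1, ±2}`, `m` odd squarefree;
  `card_filter_squarefree_eq_sum_card` with `Q = 2`): each of the `≤ 5` fibres has at most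
  `#{m ≤ X odd squarefree}` elements and the fibre `δ = 1` lies in `𝓕` (`δ χ₄(m) m ≡ δ (mod 4)`);
  hence `#{d ∈ 𝓕 : |d| ≤ X} ≥ X / 20` (`natCard_emod_four_ge`).
* `tendsto_familyProportion_one_of_twistDensity_zero` — A DENSITY-ZERO EXCEPTIONAL SET IS
  NEGLIGIBLE INSIDE `𝓕`: if `{d ≡ 1 (mod 4) : ¬ P d}` has `twistDensity` `0`, then `P` holds for
  `100 %` of `d ∈ 𝓕` (squeeze `1 − 5 B/S ≤ A/F ≤ 1`).

References: A. Smith, arXiv:2503.17619 (2025), §1 (normalisation of the twist family)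
[arXiv250317619]; standard squarefree counting [MontgomeryVaughan2007, §2.1].
-/

set_option linter.dupNamespace false
set_option autoImplicit false

noncomputable section

open scoped Classical

open Filter Topology Finset ZMod WeierstrassCurve Literature.NumberTheory.EllipticCurves

namespace Summit.BirchSwinnertonDyer.BirchSwinnertonDyer.Theorems.GoldfeldGoodTwists

/-- `δ χ₄(m) m ≡ δ (mod 4)` for odd `m` (`χ₄(m) m ≡ m² ≡ 1`). [folklore] -/
theorem mul_χ₄_mul_emod_four (δ : ℤ) {m : ℕ} (hm : Odd m) :
    (δ * χ₄ (m : ZMod 4) * m) % 4 = δ % 4 := by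
  have h1 : (χ₄ (m : ZMod 4) * m : ℤ) % 4 = 1 := by
    rcases Nat.odd_mod_four_iff.mp (Nat.odd_iff.mp hm) with h | h
    · rw [χ₄_nat_one_mod_four h, one_mul]; omega
    · rw [χ₄_nat_three_mod_four h, neg_one_mul]; omega
  rw [mul_assoc, Int.mul_emod, h1, mul_one, Int.emod_emod_of_dvd _ (by norm_num)]

/-- **`𝓕` has positive lower density** (finset form):
`#{d squarefree, |d| ≤ X} ≤ 5 · #{d ∈ 𝓕 : |d| ≤ X}`. Along the decomposition `d = δ χ₄(m) m`
(`δ ∈ {±1, ±2}`, `m` odd squarefree, `card_filter_squarefree_eq_sum_card` with `Q = 2`) each of the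
`≤ 5` fibres has at most `#{m ≤ X odd squarefree}` elements, and the fibre `δ = 1` lies in `𝓕`.
[folklore] -/
theorem card_squarefree_le_five_mul_card_emod_four_eq_one (X : ℕ) :
    ((Icc (-(X : ℤ)) X).filter fun d : ℤ ↦ Squarefree d).card ≤
      5 * ((Icc (-(X : ℤ)) X).filter fun d : ℤ ↦ Squarefree d ∧ d % 4 = 1).card := by
  have hA := card_filter_squarefree_eq_sum_card' (Q := 2) two_pos (dvd_refl 2) X
  have hB := card_filter_squarefree_eq_sum_card (Q := 2) two_pos (dvd_refl 2)
    (fun d : ℤ ↦ d % 4 = 1) X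
  set T : Finset ℤ := (Icc (-((2 : ℕ) : ℤ)) (2 : ℕ)).filter
    (fun δ ↦ Squarefree δ ∧ δ ∣ ((2 : ℕ) : ℤ)) with hT
  set M : Finset ℕ := (Icc 1 X).filter fun m : ℕ ↦ Squarefree m ∧ m.Coprime 2 with hM
  have h1 : ∀ δ ∈ T, ((Icc 1 (X / δ.natAbs)).filter
      fun m : ℕ ↦ Squarefree m ∧ m.Coprime 2).card ≤ M.card := fun δ _ ↦
    card_le_card (filter_subset_filter _ (Icc_subset_Icc le_rfl (Nat.div_le_self _ _)))
  have hTcard : T.card ≤ 5 := (card_filter_le _ _).trans (by simp)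
  have h1T : (1 : ℤ) ∈ T := by
    simp only [hT, mem_filter, mem_Icc]
    exact ⟨by omega, squarefree_one, one_dvd _⟩
  have h2 : M.card ≤ ((Icc 1 (X / (1 : ℤ).natAbs)).filter fun m : ℕ ↦
      Squarefree m ∧ m.Coprime 2 ∧ (1 * χ₄ (m : ZMod 4) * m) % 4 = 1).card := by
    refine card_le_card fun m hm ↦ ?_
    simp only [hM, mem_filter, mem_Icc] at hm ⊢
    refine ⟨by simpa using hm.1, hm.2.1, hm.2.2, ?_⟩
    rw [mul_χ₄_mul_emod_four 1 (odd_of_coprime_of_two_dvd (dvd_refl 2) hm.2.2)]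
    norm_num
  calc ((Icc (-(X : ℤ)) X).filter fun d : ℤ ↦ Squarefree d).card
      = ∑ δ ∈ T, ((Icc 1 (X / δ.natAbs)).filter
          fun m : ℕ ↦ Squarefree m ∧ m.Coprime 2).card := hA
    _ ≤ ∑ δ ∈ T, M.card := sum_le_sum h1
    _ = T.card * M.card := by rw [sum_const, smul_eq_mul]
    _ ≤ 5 * M.card := Nat.mul_le_mul_right _ hTcard
    _ ≤ 5 * ((Icc 1 (X / (1 : ℤ).natAbs)).filter fun m : ℕ ↦
          Squarefree m ∧ m.Coprime 2 ∧ (1 * χ₄ (m : ZMod 4) * m) % 4 = 1).card :=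
        Nat.mul_le_mul_left _ h2
    _ ≤ 5 * ∑ δ ∈ T, ((Icc 1 (X / δ.natAbs)).filter fun m : ℕ ↦
          Squarefree m ∧ m.Coprime 2 ∧ (δ * χ₄ (m : ZMod 4) * m) % 4 = 1).card :=
        Nat.mul_le_mul_left _ (single_le_sum (f := fun δ ↦ ((Icc 1 (X / δ.natAbs)).filter
          fun m : ℕ ↦ Squarefree m ∧ m.Coprime 2 ∧ (δ * χ₄ (m : ZMod 4) * m) % 4 = 1).card)
          (fun _ _ ↦ Nat.zero_le _) h1T)
    _ = 5 * ((Icc (-(X : ℤ)) X).filter fun d : ℤ ↦ Squarefree d ∧ d % 4 = 1).card := by rw [hB]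

/-- **`𝓕` has positive lower density** (set form): `#{d squarefree : |d| ≤ X} ≤ 5 · #{d ∈ 𝓕 : |d| ≤ X}`.
[folklore] -/
theorem natCard_squarefree_le_five_mul (X : ℕ) :
    Nat.card {d : ℤ | Squarefree d ∧ |d| ≤ (X : ℤ)} ≤
      5 * Nat.card {d : ℤ | Squarefree d ∧ |d| ≤ (X : ℤ) ∧ d % 4 = 1} := by
  rw [natCard_setOf_squarefree_eq', natCard_setOf_squarefree_eq]
  refine (card_squarefree_le_five_mul_card_emod_four_eq_one X).trans
    (Nat.mul_le_mul_left _ (card_le_card fun x hx ↦ ?_))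
  simp only [mem_filter] at hx ⊢
  exact hx

/-- `#{d ∈ 𝓕 : |d| ≤ X} ≥ X / 20`. [folklore] -/
theorem natCard_emod_four_ge (X : ℕ) :
    (X : ℝ) / 20 ≤ Nat.card {d : ℤ | Squarefree d ∧ |d| ≤ (X : ℤ) ∧ d % 4 = 1} := by
  have h1 : (X : ℝ) / 4 ≤ Nat.card {d : ℤ | Squarefree d ∧ |d| ≤ (X : ℤ)} := by
    rw [natCard_setOf_squarefree_eq']; exact sqfreeCount_true_ge X
  have h2 : (Nat.card {d : ℤ | Squarefree d ∧ |d| ≤ (X : ℤ)} : ℝ) ≤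
      5 * Nat.card {d : ℤ | Squarefree d ∧ |d| ≤ (X : ℤ) ∧ d % 4 = 1} := by
    exact_mod_cast natCard_squarefree_le_five_mul X
  linarith

/-- `#{d ∈ 𝓕 : |d| ≤ X} > 0` for `X ≥ 1`. [folklore] -/
theorem natCard_emod_four_pos {X : ℕ} (hX : 1 ≤ X) :
    (0 : ℝ) < Nat.card {d : ℤ | Squarefree d ∧ |d| ≤ (X : ℤ) ∧ d % 4 = 1} := by
  have h := natCard_emod_four_ge X
  have hX1 : (1 : ℝ) ≤ X := by exact_mod_cast hX
  linarith

/-- The sets `{d squarefree : |d| ≤ X, P d}` are finite. [folklore] -/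
theorem finite_setOf_squarefree (P : ℤ → Prop) (X : ℕ) :
    Set.Finite {d : ℤ | Squarefree d ∧ |d| ≤ (X : ℤ) ∧ P d} :=
  (Set.finite_Icc (-(X : ℤ)) X).subset fun _ hd ↦ Set.mem_Icc.mpr (abs_le.mp hd.2.1)

/-- `#{d ∈ 𝓕 : |d| ≤ X, P d} + #{d ∈ 𝓕 : |d| ≤ X, ¬ P d} = #{d ∈ 𝓕 : |d| ≤ X}`. [folklore] -/
theorem natCard_emod_four_add (P : ℤ → Prop) (X : ℕ) :
    Nat.card {d : ℤ | Squarefree d ∧ |d| ≤ (X : ℤ) ∧ (d % 4 = 1 ∧ P d)} +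
      Nat.card {d : ℤ | Squarefree d ∧ |d| ≤ (X : ℤ) ∧ (d % 4 = 1 ∧ ¬ P d)} =
      Nat.card {d : ℤ | Squarefree d ∧ |d| ≤ (X : ℤ) ∧ d % 4 = 1} := by
  rw [Nat.card_coe_set_eq, Nat.card_coe_set_eq, Nat.card_coe_set_eq,
    ← Set.ncard_union_eq (Set.disjoint_left.mpr fun _ hd hd' ↦ hd'.2.2.2 hd.2.2.2)
      (finite_setOf_squarefree _ X) (finite_setOf_squarefree _ X)]
  congr 1
  ext d
  simp only [Set.mem_union, Set.mem_setOf_eq]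
  tauto

/-- **A density-zero exceptional set is negligible inside `𝓕`.** If the squarefree `d ≡ 1 (mod 4)`
violating `P` have density `0` among all squarefree `d` (`twistDensity`), then `P` holds for `100 %`
of `𝓕`: `#{d ∈ 𝓕 : |d| ≤ X, P d} / #{d ∈ 𝓕 : |d| ≤ X} → 1`, because `𝓕` has positive lower density
(`natCard_squarefree_le_five_mul`). [folklore] -/
theorem tendsto_familyProportion_one_of_twistDensity_zero {P : ℤ → Prop}
    (h : twistDensity (fun d ↦ d % 4 = 1 ∧ ¬ P d) 0) :
    Tendsto (fun X : ℕ ↦ (Nat.card {d : ℤ | Squarefree d ∧ |d| ≤ (X : ℤ) ∧ (d % 4 = 1 ∧ P d)} : ℝ) /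
      Nat.card {d : ℤ | Squarefree d ∧ |d| ≤ (X : ℤ) ∧ d % 4 = 1}) atTop (𝓝 1) := by
  unfold twistDensity at h
  have hAB : ∀ X : ℕ, (Nat.card {d : ℤ | Squarefree d ∧ |d| ≤ (X : ℤ) ∧ (d % 4 = 1 ∧ P d)} : ℝ) +
      Nat.card {d : ℤ | Squarefree d ∧ |d| ≤ (X : ℤ) ∧ (d % 4 = 1 ∧ ¬ P d)} =
      Nat.card {d : ℤ | Squarefree d ∧ |d| ≤ (X : ℤ) ∧ d % 4 = 1} := fun X ↦ by
    exact_mod_cast natCard_emod_four_add P X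
  have hSF : ∀ X : ℕ, (Nat.card {d : ℤ | Squarefree d ∧ |d| ≤ (X : ℤ)} : ℝ) ≤
      5 * Nat.card {d : ℤ | Squarefree d ∧ |d| ≤ (X : ℤ) ∧ d % 4 = 1} := fun X ↦ by
    exact_mod_cast natCard_squarefree_le_five_mul X
  have hB0 : ∀ X : ℕ,
      (0 : ℝ) ≤ Nat.card {d : ℤ | Squarefree d ∧ |d| ≤ (X : ℤ) ∧ (d % 4 = 1 ∧ ¬ P d)} :=
    fun X ↦ Nat.cast_nonneg _
  -- squeeze between `1 - 5 B/S` and `1`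
  have hlo : Tendsto (fun X : ℕ ↦ 1 - 5 *
      ((Nat.card {d : ℤ | Squarefree d ∧ |d| ≤ (X : ℤ) ∧ (d % 4 = 1 ∧ ¬ P d)} : ℝ) /
        Nat.card {d : ℤ | Squarefree d ∧ |d| ≤ (X : ℤ)})) atTop (𝓝 1) := by
    have := (tendsto_const_nhds (x := (5 : ℝ))).mul h
    rw [mul_zero] at this
    simpa using (tendsto_const_nhds (x := (1 : ℝ))).sub this
  refine tendsto_of_tendsto_of_tendsto_of_le_of_le' hlo tendsto_const_nhds ?_ ?_
  · filter_upwards [eventually_ge_atTop 1] with X hX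
    have hF0 := natCard_emod_four_pos hX
    have hS0 : (0 : ℝ) < Nat.card {d : ℤ | Squarefree d ∧ |d| ≤ (X : ℤ)} := by
      have h1 : (X : ℝ) / 4 ≤ Nat.card {d : ℤ | Squarefree d ∧ |d| ≤ (X : ℤ)} := by
        rw [natCard_setOf_squarefree_eq']; exact sqfreeCount_true_ge X
      have hX1 : (1 : ℝ) ≤ X := by exact_mod_cast hX
      linarith
    rw [show (Nat.card {d : ℤ | Squarefree d ∧ |d| ≤ (X : ℤ) ∧ (d % 4 = 1 ∧ P d)} : ℝ) =
      Nat.card {d : ℤ | Squarefree d ∧ |d| ≤ (X : ℤ) ∧ d % 4 = 1} -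
      Nat.card {d : ℤ | Squarefree d ∧ |d| ≤ (X : ℤ) ∧ (d % 4 = 1 ∧ ¬ P d)} by linarith [hAB X],
      sub_div, div_self hF0.ne']
    have : (Nat.card {d : ℤ | Squarefree d ∧ |d| ≤ (X : ℤ) ∧ (d % 4 = 1 ∧ ¬ P d)} : ℝ) /
        Nat.card {d : ℤ | Squarefree d ∧ |d| ≤ (X : ℤ) ∧ d % 4 = 1} ≤
        5 * ((Nat.card {d : ℤ | Squarefree d ∧ |d| ≤ (X : ℤ) ∧ (d % 4 = 1 ∧ ¬ P d)} : ℝ) /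
          Nat.card {d : ℤ | Squarefree d ∧ |d| ≤ (X : ℤ)}) := by
      rw [← mul_div_assoc, div_le_div_iff₀ hF0 hS0]
      nlinarith [hSF X, hB0 X]
    linarith
  · filter_upwards [eventually_ge_atTop 1] with X hX
    have hF0 := natCard_emod_four_pos hX
    rw [div_le_one hF0]
    linarith [hAB X, hB0 X]

end Summit.BirchSwinnertonDyer.BirchSwinnertonDyer.Theorems.GoldfeldGoodTwists

end
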